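import Literature.AnabelianGeometry.SemiGraphs.TemperedPiExistence
import Literature.AnabelianGeometry.SemiGraphs.GaloisApproxProofs
import HarnessLib

/-!
# The levels of the Galois tower of [SemiAnbd] Prop 3.6 are connected coverings ([SemiAnbd] §3 p. 38)

Mochizuki, *Semi-graphs of anabelioids*, Publ. RIMS **42** (2006) [MochizukiSemiAnbd2006], proof of
Prop. 3.6 (i) p. 38: "`π₁^temp(𝒢) := lim_i Gal(𝒢_{∞,i}/𝒢)` … over a cofinal system of CONNECTED finite étale
Galois coverings `𝒢_i → 𝒢`".

Proof-only bookkeeping for the (β) assembly of Thm. 3.7 (iii) (seat abc-iut-L3-t8 gen 4, row (β)-ASM): the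
levels `S n = ofBObj (tower n)` of seat abc-iut-L3-t9's `galoisLevelData h36` are connected as coverings —
any two points lie in one component — since the tower consists of connected (Galois) objects of `B(𝒢)`
(seat abc-iut-w4-d098's `sameComponent_ofBObj_of_isConnected`).  This is the hypothesis `hconn` of
`GaloisLevelData.finiteLevelDataOfTower` / `compactInVerticial_of_towerDictionary` at the constructed tower;
the companions `hfin` / `hne` are `galoisLevelData_isFinite` / `galoisLevelData_hasNonemptyFibres`
(`TemperedPiChartExists.lean`).  Nothing here bears on [IUTchIII] Cor. 3.12.
-/

namespace Literature.AnabelianGeometry.SemiGraphs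

namespace ProfiniteSemiGraph

open CategoryTheory

universe u

variable (𝒢 : ProfiniteSemiGraph.{u}) (h36 : 𝒢.Prop36Hypotheses)

/-- **The levels `S n` of the Galois tower are connected coverings**: any two points of `S n` lie in the
same component (the tower objects are Galois, hence connected, in `B(𝒢)`).
[cite: MochizukiSemiAnbd2006, Prop 3.6(i) p.38] -/
theorem galoisLevelData_sameComponent (n : ℕ) (p q : ((𝒢.galoisLevelData h36).S n).Point) :
    ((𝒢.galoisLevelData h36).S n).SameComponent p q :=
  letI := SemiGraphOfAnabelioids.galoisCategory_bObj 𝒢.toAnab ⟨h36.isConnected⟩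
  sameComponent_ofBObj_of_isConnected h36.isConnected (𝒢.tower h36 n)
    (𝒢.isGalois_tower h36 n).toIsConnected p q

/-- The same, in the binder shape `hconn : ∀ n p q, (D.S n).SameComponent p q` of
`GaloisLevelData.finiteLevelDataOfTower`. [cite: MochizukiSemiAnbd2006, Prop 3.6(i) p.38] -/
theorem galoisLevelData_hconn :
    ∀ (n : ℕ) (p q : ((𝒢.galoisLevelData h36).S n).Point), ((𝒢.galoisLevelData h36).S n).SameComponent p q :=
  𝒢.galoisLevelData_sameComponent h36

end ProfiniteSemiGraph

end Literature.AnabelianGeometry.SemiGraphs
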